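import Summits.QuantumFields.YangMills.Theorems.IR.Negative.FixedMesh.TwistedPairs
import Summits.QuantumFields.YangMills.Theorems.IR.Negative.FixedMesh.Stokes

/-!
# Crux `IR` (stmt-QuantumFields-19354), registered hedge cut `af-pincer-T` (skeleton sha16 0308f95ca6f6a115):
# THE FIXED-MESH NEGATIVE FOR FORMAT T and THE ONSET FLOOR — Negative lane landing (disprove-1 g4, `--supports` 19354)

WHAT IS PROVED (sorry-free; axioms `propext`, `Classical.choice`, `Quot.sound`), against the `OnsetFormats` mirror
(`Theorems/IR/Negative/OnsetMixingTypicalFalseOfMassWire.lean`) of the REGISTERED format `TypShellCond` and stub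
statement `OnsetMixingTypical` (= `stub_onsetT`, clause (i_T) with the full measurable `[0,1]`-valued cell-0 test
class, owner R48: F-full FINAL):

* `not_typShellCond_fixedMesh` — for every compact `G`, every continuous faithful unitary `ρ : G →* M_N(ℂ)`, `N ≥ 1`,
  carrying a central `g₀` as a scalar `ρ g₀ = c • 1`, `c ≠ 1` (`SU(N)` fundamental, `ℤ_N`, `U(1)` charge `q`), every
  mesh `b ≥ 1`, window parameter `n`, budgets `0 ≤ ε`, `16 ε < ‖1 − c‖`, `0 ≤ δ`, `4 · #windowCellsPlus(n) · δ < 1`: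
  `∃ β₀ ∀ β ≥ β₀, ¬ TypShellCond ρ β b n ε δ`;
* `typOnsetFloor` — the same uniformly on every bounded mesh range `1 ≤ b ≤ B` (the typical onset `b⋆_T(β)` exceeds
  every bound eventually); `typOnsetFloor_SU2` — the instance `SU(2)`, fundamental representation, `g₀ = −1`, `c = −1`
  (`0 ≤ ε < 1/8`);
* `not_onsetMixingTypicalBdd : ¬ OnsetMixingTypicalBdd` — the NATURAL STRENGTHENING of the registered stub with a
  `β`-UNIFORM mesh bound (`∀ δ ∃ B(δ) ∃ β₂ ∀ β ≥ β₂ ∃ b ≤ B(δ)`; `onsetMixingTypical_of_bdd`: it implies the stub)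
  is FALSE.  The registered stub itself (`∃ b` after `∀ β`: `b = b(β, δ)` may grow) is NOT refuted — verdict of
  record for the T cut stays NOT-REFUTED (memo `pub/ym-beyond/ym-19354-disprove-1/NOT-REFUTED.md` §8–§9); this file
  is the kernel form of the calibration «under F-full the typical onset `b⋆_T(β) → ∞` for every gauge group with a
  charged centre element» (owner R44∕R48∕R51, cplan-af-pincer g5 D1, cruxidea-8 g5).

PROVENANCE.  §0–§4 are the crux-ideate seat ym-cruxidea-19354-8 GEN 5's crux workfile
`Summits/QuantumFields/YangMills/Cruxes/IR/CruxIdea8FixedMesh.lean` (tree sha16 d880b42bb52976de, namespace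
`…Cruxes.IR.CruxIdea8g5`, S1∕S2∕composition all proved there), re-homed VERBATIM under the namespace
`…Cruxes.IR.FixedMesh` with three changes: (a) the local copies of `TypShellCond`∕`shellCount` are replaced by the
`OnsetFormats` mirrors (identical text), so the theorems speak about the objects `OnsetMixingTypical` is stated with;
(b) the skeleton import `Cruxes.IR.Lines.birth` (Theses cone, sorry-tolerant) is replaced by its Theorems∕Literature
providers; (c) `stub_twistedTypicalPairs`∕`stub_torusLoopFreezing` are renamed `twistedTypicalPairs`∕`torusLoopFreezing`
(they are theorems); and the material is split by topic into the five modules `Theorems/IR/Negative/FixedMesh/`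
`{LayerTwist, ClauseI, Loop, TwistedPairs, Stokes}.lean` (parts 1–5: p506930, p508208, p508762, p509342, p509888) below this headline module
(part 6: the composition §4g and the new §5).  A crux workfile is scratch (only required to elaborate) and no Theorems
module imports one; landing authorised count-neutral for the disprove∕helper lane by the route owner (R51,
2026-08-27T06:11Z).  The engine module `TunedSequenceExists/Negative/Freezing.lean` had an unused route-file import
(`Theses.ParabolicTrajectory`); proposal p506438 replaces it by Literature imports so that this cone is Theses-free.

CHAIN (standard mesh-`b` frame, region `Y = rowCells n`, twist `τ_1` by the central `g₀`):
* §0 the layer twist `τ_k` is a gauge transformation (`layerTwist_eq_gaugeTransformZd`); §1 Wilson-kernel covariance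
  (`ymSpecification_map_layerTwist`) and the charged identity `∫ g dγ(τ_k ζ) = c ∫ g dγ(ζ)`; §2 clause (i_T) isolated
  (`ClauseI`, `clauseI_of_typShellCond`); §3 (i_T) at the row ⇒ `‖∫ g dγ_row(ζ)‖ ≤ 4ε/‖1−c‖` for every charged cell-0
  cylinder `g`, `‖g‖ ≤ 1`, at every datum `ζ` typical together with `τ_1 ζ` off the row
  (`norm_integral_charged_le_of_clauseI`);
* §4 the data-adapted charged test `chargedTest ζ U = tr ρ(col_b U · staple ζ)/N` and the rectangle loop `loopObs`
  (cylinder, continuous, `|·| ≤ 1`), properness and the torus DLR equation (`integral_loopObs_torus`), S1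
  `twistedTypicalPairs` (torus anchor (iii_T) + torus gauge invariance ⇒ the twisted typical pairs
  `(lift V, τ_1 lift V)` have mass `≥ 1 − 2·#cells·δ`), S2 `torusLoopFreezing` (fixed odd torus, `β → ∞`:
  `E_β[loopObs ∘ lift] → 1` by the tree's Laplace concentration `Freezing.tendsto_integral_wilsonMeasure` + zero action
  ⇒ flat lift ⇒ planar lattice Stokes `col · staple = 1`), composition `not_typShellCond_fixedMesh`
  (`3/4 ≤ E ≤ 4ε/‖1−c‖ + 2·#cells·δ < 1/4 + 1/2`);
* §5 `typOnsetFloor` (finite maximum of thresholds), the `SU(2)` data (`negOneSU2`, `fundRepSU2`), the bounded-mesh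
  strengthening `OnsetMixingTypicalBdd`, `onsetMixingTypical_of_bdd`, `not_onsetMixingTypicalBdd`.

READING (numbers, not adjectives).  The freezing input S2 lives on ONE torus of side `2((2n+2)b+1)+1` at fixed `b`; it
dies exactly when area × string tension `(2n+1) b² σ(β) ≳ 1`, i.e. at `b ≍ ξ_G(β)`: the obstruction binds for
`b ≪ ξ_G` and is gone for `b ≫ ξ_G` — consistent with the expected truth of `stub_onsetT` with `b⋆_T(β) ≍ ξ_G(β)`.
What WOULD refute the registered stub is a mesh-UNIFORM version of S1–S2 at every `b` simultaneously for all large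
`β`, i.e. `OnsetFormats.MassWire` (no finite correlation length; `not_onsetMixingTypical_of_massWireSU2`, p500647) —
not constructible.  Elementary given the tree: Mathlib + landed Theorems∕Literature modules; no named facts used as
hypotheses (`isSimpleCompactGroup_specialUnitaryGroup_holds` is a tree theorem); no `sorry`.
-/

set_option autoImplicit false

noncomputable section

open MeasureTheory Filter Topology
open Literature.MathematicalPhysics.QuantumLattice
open Literature.Probability.LatticeModels
open Summit.QuantumFields.YangMills.Cruxes.IR.Tempered (cellEdges windowCells regionEdges)
open Summit.QuantumFields.YangMills.Cruxes.IR.ShellTempered (windowCellsPlus)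
open Summit.QuantumFields.YangMills.Cruxes.IR.OnsetFormats (TypShellCond shellCount OnsetMixingTypical)

namespace Summit.QuantumFields.YangMills.Cruxes.IR.FixedMesh

section FixedMesh

open Literature.MathematicalPhysics.QuantumFieldTheory (wilsonMeasure GaugeConfig isProbabilityMeasure_wilsonMeasure
  measurable_torusLift gaugeTransform wilsonMeasure_map_gaugeTransform_holds wilsonAction)
open Summit.QuantumFields.YangMills.Theorems.TunedSequenceExists.Negative.Freezing (tendsto_integral_wilsonMeasure
  re_trace_le_of_mem_unitaryGroup re_trace_eq_of_wilsonAction_eq_zero plaquetteHolonomyZd_torusLift')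

variable {G : Type} [Group G] [TopologicalSpace G] [IsTopologicalGroup G] [CompactSpace G]
  [SecondCountableTopology G] [MeasurableSpace G] [BorelSpace G]
  {N : ℕ} (ρ : G →* Matrix (Fin N) (Fin N) ℂ)


/-! ### 4g. The composition (PROVED from S1, S2) -/

omit [TopologicalSpace G] [IsTopologicalGroup G] [CompactSpace G] [SecondCountableTopology G]
  [MeasurableSpace G] [BorelSpace G] in
/-- Frame bounds: every window+shell cell of the standard frame sits in the fundamental domain `[-S, S]⁴`,
`S = (2n+2)b + 1`. -/
theorem stdFrame_windowCellsPlus_bounds {b n : ℕ} {c : Fin 4 → ℤ} (hc : c ∈ windowCellsPlus n) :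
    ∀ i, -(((2 * n + 2) * b + 1 : ℕ) : ℤ) ≤ stdFrame b i (c i) ∧
      stdFrame b i (c i + 1) ≤ (((2 * n + 2) * b + 1 : ℕ) : ℤ) + 1 := by
  intro i
  have hci : -(2 * (n : ℤ) + 1) ≤ c i ∧ c i ≤ 2 * (n : ℤ) + 1 := by
    have := Fintype.mem_piFinset.1 hc i
    simpa [Finset.mem_Icc] using this
  have hb : (0 : ℤ) ≤ b := Int.natCast_nonneg b
  have h1 := mul_le_mul_of_nonneg_left hci.1 hb
  have h2 := mul_le_mul_of_nonneg_left hci.2 hb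
  push_cast
  simp only [stdFrame]
  split_ifs <;> constructor <;> nlinarith

/-- **THE FIXED-MESH NEGATIVE (PROVED from S1, S2).**  For every compact `G`, every continuous faithful unitary matrix
representation `ρ` of positive degree carrying a central element `g₀` as a scalar `c ≠ 1`, every mesh `b ≥ 1`, window
parameter `n`, mixing budget `0 ≤ ε < ‖1−c‖/16` and rarity budget `0 ≤ δ < 1/(4·#windowCellsPlus n)`:
format T FAILS at `(ρ, β, b, n, ε, δ)` for all sufficiently large `β`.  (So under (F1) the typical onset
`mixOnsetT ρ β n ε δ → ∞`: sanity∕calibration for `stub_onsetT`, not a refutation of `OnsetMixingTypical`.) -/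
theorem not_typShellCond_fixedMesh (hρ : Continuous ρ) (hρi : Function.Injective ρ)
    (hρu : ∀ g, ρ g ∈ Matrix.unitaryGroup (Fin N) ℂ) (hN : 1 ≤ N)
    {g₀ : G} (hg : g₀ ∈ Subgroup.center G) {c : ℂ} (hρc : ρ g₀ = c • (1 : Matrix (Fin N) (Fin N) ℂ))
    (hc : c ≠ 1) {b : ℕ} (hb : 1 ≤ b) (n : ℕ) {ε δ : ℝ} (hε0 : 0 ≤ ε) (hε : 16 * ε < ‖1 - c‖)
    (hδ0 : 0 ≤ δ) (hδ : 4 * ((windowCellsPlus n).card : ℝ) * δ < 1) :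
    ∃ β₀ : ℝ, ∀ β : ℝ, β₀ ≤ β → ¬ TypShellCond ρ β b n ε δ := by
  -- the torus half-side `S = (2n+2)b + 1` and the rectangle width `m = (2n+1)b`
  have hm : (((2 * n + 1) * b : ℕ) : ℤ) = (2 * (n : ℤ) + 1) * b := by push_cast; ring
  obtain ⟨β₀, hβ₀⟩ := torusLoopFreezing ρ hρ hρi hρu hN hb ((2 * n + 1) * b) ((2 * n + 2) * b + 1)
    (θ := 3 / 4) (by norm_num)
  refine ⟨β₀, fun β hβ hT => ?_⟩
  -- notation
  set L : ℕ := 2 * ((2 * n + 2) * b + 1) + 1 with hL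
  set μ := wilsonMeasure (d := 4) (L := L) ρ β with hμ
  haveI : IsProbabilityMeasure μ := isProbabilityMeasure_wilsonMeasure ρ hρ β
  set Λ := rowRegion b n with hΛ
  set F : LGConfig 4 G → ℝ := loopObs ρ b ((2 * n + 1) * b) with hF
  set Ψ : GaugeConfig 4 L G → ℝ := fun V => ∫ U, F U ∂(ymSpecification ρ β Λ (torusLift L V)) with hΨ
  -- the format at the standard frame: a class `Typ` with (i_T) and the single-cell torus anchor
  obtain ⟨Typ, hmeas, hdep, hI, hanch⟩ := clauseI_of_typShellCond hT
  have hanch' : ∀ c' ∈ windowCellsPlus n,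
      μ {V : GaugeConfig 4 L G | torusLift L V ∉ Typ c'} ≤ ENNReal.ofReal δ := fun c' hc' =>
    hanch ((2 * n + 2) * b + 1) (by nlinarith) c' (stdFrame_windowCellsPlus_bounds hc')
  -- S1: the bad set
  obtain ⟨B, hBm, hμB, hgood⟩ :=
    twistedTypicalPairs ρ β le_rfl Typ hmeas hdep hδ0 hanch' hg
  -- S2: freezing
  have hfreeze : (3 : ℝ) / 4 ≤ ∫ V, F (torusLift L V) ∂μ := hβ₀ β hβ
  -- torus DLR
  have hDLR : ∫ V, F (torusLift L V) ∂μ = ∫ V, Ψ V ∂μ := integral_loopObs_torus ρ hρ hρu β hm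
  -- pointwise: `Ψ ≤ 4ε/‖1−c‖` on the good set, `≤ 1` everywhere
  have hc' : 0 < ‖1 - c‖ := norm_pos_iff.2 (sub_ne_zero.2 (Ne.symm hc))
  have hq0 : 0 ≤ 4 * ε / ‖1 - c‖ := div_nonneg (by linarith) hc'.le
  have hΨ1 : ∀ V, |Ψ V| ≤ 1 := fun V =>
    abs_integral_ymSpecification_le ρ hρ β Λ (abs_loopObs_le ρ hρu b _) _
  have hptw : ∀ V, Ψ V ≤ 4 * ε / ‖1 - c‖ + B.indicator (1 : GaugeConfig 4 L G → ℝ) V := by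
    intro V
    by_cases hV : V ∈ B
    · rw [Set.indicator_of_mem hV, Pi.one_apply]
      linarith [(abs_le.1 (hΨ1 V)).2]
    · rw [Set.indicator_of_notMem hV, add_zero]
      exact integral_loopObs_le_of_clauseI ρ hρ hρu hb hm hI hg hρc hc _ (hgood V hV)
  -- integrate
  have hΨm : Measurable Ψ :=
    ((continuous_integral_ymSpecification ρ hρ β Λ (continuous_loopObs ρ hρ b _)
      (abs_loopObs_le ρ hρu b _)).comp (continuous_torusLift L)).measurable
  have hΨi : Integrable Ψ μ :=
    (integrable_const (1 : ℝ)).mono' hΨm.aestronglyMeasurable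
      (ae_of_all _ fun V => by simpa [Real.norm_eq_abs] using hΨ1 V)
  have hBi1 : Integrable (B.indicator (1 : GaugeConfig 4 L G → ℝ)) μ :=
    (integrable_const (1 : ℝ)).indicator hBm
  have hBi : Integrable (fun V => 4 * ε / ‖1 - c‖ + B.indicator (1 : GaugeConfig 4 L G → ℝ) V) μ :=
    (integrable_const _).add hBi1
  have hint : ∫ V, Ψ V ∂μ ≤ 4 * ε / ‖1 - c‖ + μ.real B := by
    calc ∫ V, Ψ V ∂μ ≤ ∫ V, (4 * ε / ‖1 - c‖ + B.indicator (1 : GaugeConfig 4 L G → ℝ) V) ∂μ :=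
          integral_mono hΨi hBi hptw
      _ = 4 * ε / ‖1 - c‖ + μ.real B := by
          rw [integral_add (integrable_const _) hBi1, integral_const, integral_indicator_one hBm]
          simp [Measure.real]
  have hμB' : μ.real B ≤ 2 * ((windowCellsPlus n).card : ℝ) * δ :=
    ENNReal.toReal_le_of_le_ofReal (by positivity) hμB
  have hq : 4 * ε / ‖1 - c‖ < 1 / 4 := by
    rw [div_lt_iff₀ hc']
    linarith
  linarith


end FixedMesh

/-! ## §5 (Negative lane, disprove-1 g4) The onset floor: format T fails on every BOUNDED mesh range at large `β`;
the natural strengthening of the registered stub `stub_onsetT : OnsetMixingTypical` with a `β`-uniform mesh bound is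
FALSE (witness `SU(2)`, fundamental representation, centre element `−1`) -/

section Floor

variable {G : Type} [Group G] [TopologicalSpace G] [IsTopologicalGroup G] [CompactSpace G]
  [SecondCountableTopology G] [MeasurableSpace G] [BorelSpace G]
  {N : ℕ} (ρ : G →* Matrix (Fin N) (Fin N) ℂ)

/-- **The onset floor, uniform on a bounded mesh range.**  Under the hypotheses of `not_typShellCond_fixedMesh`
(compact `G`, continuous faithful unitary `ρ` of degree `N ≥ 1`, a central `g₀` with `ρ g₀ = c • 1`, `c ≠ 1`,
budgets `0 ≤ ε`, `16 ε < ‖1 − c‖`, `0 ≤ δ`, `4 · #windowCellsPlus(n) · δ < 1`), for every mesh bound `B` there is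
`β₁` such that for all `β ≥ β₁` NO mesh `1 ≤ b ≤ B` satisfies format T: the typical onset `b⋆_T(β)` exceeds every
bound eventually (finite maximum of the fixed-mesh thresholds `β₀(b)`, `b ≤ B`). -/
theorem typOnsetFloor (hρ : Continuous ρ) (hρi : Function.Injective ρ)
    (hρu : ∀ g, ρ g ∈ Matrix.unitaryGroup (Fin N) ℂ) (hN : 1 ≤ N)
    {g₀ : G} (hg : g₀ ∈ Subgroup.center G) {c : ℂ} (hρc : ρ g₀ = c • (1 : Matrix (Fin N) (Fin N) ℂ))
    (hc : c ≠ 1) (n : ℕ) {ε δ : ℝ} (hε0 : 0 ≤ ε) (hε : 16 * ε < ‖1 - c‖)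
    (hδ0 : 0 ≤ δ) (hδ : 4 * ((windowCellsPlus n).card : ℝ) * δ < 1) (B : ℕ) :
    ∃ β₁ : ℝ, ∀ β : ℝ, β₁ ≤ β → ∀ b : ℕ, 1 ≤ b → b ≤ B → ¬ TypShellCond ρ β b n ε δ := by
  induction B with
  | zero => exact ⟨0, fun β _ b hb hb0 => absurd hb (by omega)⟩
  | succ B ih =>
    obtain ⟨β₁, h₁⟩ := ih
    obtain ⟨β₀, h₀⟩ :=
      not_typShellCond_fixedMesh ρ hρ hρi hρu hN hg hρc hc (b := B + 1) (by omega) n hε0 hε hδ0 hδ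
    refine ⟨max β₁ β₀, fun β hβ b hb hbB => ?_⟩
    rcases Nat.lt_or_ge b (B + 1) with hlt | hge
    · exact h₁ β ((le_max_left _ _).trans hβ) b hb (by omega)
    · obtain rfl : b = B + 1 := le_antisymm hbB hge
      exact h₀ β ((le_max_right _ _).trans hβ)

end Floor

section SU2

open Literature.MathematicalPhysics.QuantumFieldTheory (LatticeRep IsCompactSimpleLieGroup
  isCompactSimpleLieGroup_specialUnitaryGroup)

/-- Admissible `(n, ε)` (`ε · M(n) < 1`, `0 ≤ ε`) have `16 ε < 1` (`M(n) ≥ 16`). -/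
theorem sixteen_mul_eps_lt_one {n : ℕ} {ε : ℝ} (hM : ε * shellCount n < 1) (hε0 : 0 ≤ ε) : 16 * ε < 1 := by
  have h16 : 16 ≤ (4 * n + 3) ^ 4 - (4 * n + 1) ^ 4 := by
    apply Nat.le_sub_of_add_le
    calc 16 + (4 * n + 1) ^ 4
        ≤ 16 + (4 * n + 1) ^ 4 + (8 * (4 * n + 1) ^ 3 + 24 * (4 * n + 1) ^ 2 + 32 * (4 * n + 1)) :=
          Nat.le_add_right _ _
      _ = (4 * n + 3) ^ 4 := by ring
  have hMge : (16 : ℝ) ≤ shellCount n := by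
    unfold shellCount
    exact_mod_cast h16
  nlinarith

/-- The centre element `−1 ∈ SU(2)`. [folklore] -/
def negOneSU2 : Matrix.specialUnitaryGroup (Fin 2) ℂ :=
  ⟨-1, by
    rw [Matrix.mem_specialUnitaryGroup_iff]
    refine ⟨?_, by simp [Matrix.det_neg, Matrix.det_one]⟩
    rw [Matrix.mem_unitaryGroup_iff]
    simp⟩

/-- `−1` is central in `SU(2)`. [folklore] -/
theorem negOneSU2_mem_center : negOneSU2 ∈ Subgroup.center (Matrix.specialUnitaryGroup (Fin 2) ℂ) :=
  Subgroup.mem_center_iff.2 fun g => Subtype.ext (by simp [negOneSU2])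

/-- The fundamental representation carries `−1` as the scalar `−1`. [folklore] -/
theorem fundamentalRep_negOneSU2 :
    fundamentalRep (Fin 2) negOneSU2 = (-1 : ℂ) • (1 : Matrix (Fin 2) (Fin 2) ℂ) := by
  rw [fundamentalRep_apply, neg_one_smul]
  rfl

/-- `‖1 − (−1)‖ = 2` in `ℂ`. -/
theorem norm_one_sub_neg_one : ‖(1 : ℂ) - (-1)‖ = 2 := by
  rw [sub_neg_eq_add, one_add_one_eq_two]
  exact Complex.norm_two

/-- The fundamental lattice representation datum of `SU(2)` (faithful, continuous, unitary, degree 2). -/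
def fundRepSU2 : LatticeRep (Matrix.specialUnitaryGroup (Fin 2) ℂ) :=
  ⟨2, fundamentalRep (Fin 2), continuous_fundamentalRep _, fundamentalRep_injective _,
    fundamentalRep_mem_unitaryGroup⟩

/-- **The `SU(2)` onset floor.**  For the fundamental representation of `SU(2)`, every `n`, budgets `0 ≤ ε < 1/8`,
`0 ≤ δ < 1 / (4 · #windowCellsPlus n)` and every mesh bound `B`: for all large `β` no mesh `1 ≤ b ≤ B` satisfies
format T. -/
theorem typOnsetFloor_SU2 [MeasurableSpace (Matrix.specialUnitaryGroup (Fin 2) ℂ)]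
    [BorelSpace (Matrix.specialUnitaryGroup (Fin 2) ℂ)] (n : ℕ) {ε δ : ℝ} (hε0 : 0 ≤ ε) (hε : 8 * ε < 1)
    (hδ0 : 0 ≤ δ) (hδ : 4 * ((windowCellsPlus n).card : ℝ) * δ < 1) (B : ℕ) :
    ∃ β₁ : ℝ, ∀ β : ℝ, β₁ ≤ β → ∀ b : ℕ, 1 ≤ b → b ≤ B →
      ¬ TypShellCond (fundamentalRep (Fin 2)) β b n ε δ :=
  typOnsetFloor (fundamentalRep (Fin 2)) (continuous_fundamentalRep _) (fundamentalRep_injective _)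
    fundamentalRep_mem_unitaryGroup (by norm_num) negOneSU2_mem_center fundamentalRep_negOneSU2 (by norm_num) n
    hε0 (by rw [norm_one_sub_neg_one]; linarith) hδ0 hδ B

/-- **The registered stub with a `β`-UNIFORM mesh bound** — `OnsetMixingTypical` (= `stub_onsetT` of skeleton
`af-pincer-T`, sha16 0308f95ca6f6a115, mirrored verbatim in `OnsetFormats`) with, for each rarity budget `δ`, a bound
`B = B(δ)` in front of `∃ β₂ ∀ β ≥ β₂` and the witness mesh confined to `1 ≤ b ≤ B`: "at every rarity budget typical
strong mixing sets in at a mesh bounded uniformly in `β`" (the weakest bounded-mesh form: `B` may depend on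
`G, r, n, ε, δ` — only not on `β`). -/
def OnsetMixingTypicalBdd : Prop :=
  ∀ (G : Type) [Group G] [TopologicalSpace G] [IsTopologicalGroup G] [CompactSpace G],
    IsCompactSimpleLieGroup G → letI : MeasurableSpace G := borel G; haveI : BorelSpace G := ⟨rfl⟩;
    ∀ r : LatticeRep G, ∃ (n : ℕ) (ε : ℝ), 1 ≤ n ∧ 0 ≤ ε ∧ ε * shellCount n < 1 ∧
      ∀ δ : ℝ, 0 < δ → ∃ (B : ℕ) (β₂ : ℝ), ∀ β : ℝ, β₂ ≤ β →
        ∃ b : ℕ, 1 ≤ b ∧ b ≤ B ∧ TypShellCond r.ρ β b n ε δ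

/-- The bounded-mesh form is a strengthening of the registered stub statement. -/
theorem onsetMixingTypical_of_bdd (h : OnsetMixingTypicalBdd) : OnsetMixingTypical := by
  intro G _ _ _ _ hG r
  obtain ⟨n, ε, hn, hε, hM, hB⟩ := h G hG r
  refine ⟨n, ε, hn, hε, hM, fun δ hδ => ?_⟩
  obtain ⟨B, β₂, hβ₂⟩ := hB δ hδ
  refine ⟨β₂, fun β hβ => ?_⟩
  obtain ⟨b, hb, -, hT⟩ := hβ₂ β hβ
  exact ⟨b, hb, hT⟩

/-- **The bounded-mesh strengthening of `stub_onsetT` is FALSE** (witness: `SU(2)`, fundamental representation,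
centre element `−1`; at the budget `δ = 1 / (8 (#windowCellsPlus n + 1))` the onset floor `typOnsetFloor_SU2` beats
every bound `B(δ)`).  The registered stub
itself (`∃ b` AFTER `∀ β`, so `b = b(β, δ)` may grow) is NOT refuted: this is the kernel form of the calibration
"`b⋆_T(β) → ∞` for every group with a charged centre element". -/
theorem not_onsetMixingTypicalBdd : ¬ OnsetMixingTypicalBdd := by
  intro h
  letI : MeasurableSpace (Matrix.specialUnitaryGroup (Fin 2) ℂ) := borel _
  haveI : BorelSpace (Matrix.specialUnitaryGroup (Fin 2) ℂ) := ⟨rfl⟩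
  obtain ⟨n, ε, -, hε0, hM, hB⟩ := h (Matrix.specialUnitaryGroup (Fin 2) ℂ)
    (isCompactSimpleLieGroup_specialUnitaryGroup isSimpleCompactGroup_specialUnitaryGroup_holds le_rfl) fundRepSU2
  set k : ℝ := ((windowCellsPlus n).card : ℝ) with hk
  have hk0 : 0 ≤ k := Nat.cast_nonneg _
  have hδ0 : 0 < 1 / (8 * (k + 1)) := by positivity
  have hδ : 4 * k * (1 / (8 * (k + 1))) < 1 := by
    rw [show 4 * k * (1 / (8 * (k + 1))) = (4 * k) / (8 * (k + 1)) by ring, div_lt_one (by positivity)]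
    linarith
  obtain ⟨B, β₂, hβ₂⟩ := hB _ hδ0
  have h16 := sixteen_mul_eps_lt_one hM hε0
  obtain ⟨β₁, hβ₁⟩ := typOnsetFloor_SU2 n hε0 (by linarith) hδ0.le hδ B
  obtain ⟨b, hb, hbB, hT⟩ := hβ₂ (max β₁ β₂) (le_max_right _ _)
  exact hβ₁ _ (le_max_left _ _) b hb hbB hT

end SU2

end Summit.QuantumFields.YangMills.Cruxes.IR.FixedMesh

end
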